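import Mathlib
import Summits.Ventures.PercRepro2.Defs
import Summits.Ventures.PercRepro2.Graph
import Summits.Ventures.PercRepro2.OneColourSwitch
import Summits.Ventures.PercRepro2.RegionHubSign
import Summits.Ventures.PercRepro2.SideSwitch
import Summits.Ventures.PercRepro2.SideSwitchFibre
import Summits.Ventures.PercRepro2.SideSwitchClosed
import Summits.Ventures.PercRepro2.SideSwitchComps
import Summits.Ventures.PercRepro2.M9NoPocketDefs
import Summits.Ventures.PercRepro2.M9NoPocketWorld
import Summits.Ventures.PercRepro2.M9NoPocketFibre
import Summits.Ventures.PercRepro2.M9NoPocketCompl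
import Summits.Ventures.PercRepro2.M9PocketCubeDefs
import Summits.Ventures.PercRepro2.M9PocketCubeFibre
import Summits.Ventures.PercRepro2.M9PocketCubeCompl
import Summits.Ventures.PercRepro2.M9LinkedHubCube

/-!
# The `Y`-pocket of a cube vector and its group interval (blind cell PercRepro2, p3 g29,
2026-08-28; `seats/P3-G29-SUMMARY.md` «For the successor», steps (i)–(ii) of the `Y`-pocket-group
plan for the residual lemma `hdResid ≤ 0` of class C7)

On the pocket cube of a representative `ρ` (`M9PocketCubeDefs`): `pocketCfg` keeps the pocket
edges of a colouring and closes every other edge; the **`Y`-pocket** `pocketY x` of a cube vector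
is the `Y`-cluster of `d` in the pocket of the assignment of `x`; `EZ x` is the set of pocket
edges touching it (the edges at `d` included).  The **group interval** of `x` is
`[(∅, x.2 ∩ EZ x), (blocks ∖ fixedBlocks x, (x.2 ∩ EZ x) ∪ (Pk ∖ EZ x))]` — the vectors that agree
with `x` on the edges touching its `Y`-pocket, flip no `T`-edge and switch no block adjacent to
`d` or attached to the `Y`-pocket (`fixedBlocks`).  The `Y`-pocket is **constant on the group
interval** (`pocketY_eq_of_mem_groupInterval`: the pocket colourings of two members agree on every
edge touching the pocket, `expl_eq_of_eqOn_touches`), the interval lies in the cube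
(`mem_cubeP_of_mem_groupInterval`) and contains `x` when `x` flips no `T`-edge and switches no
fixed block (`self_mem_groupInterval`).  The remaining steps of the plan (every interval point is
`K`-side legal, the group complement, the tilt on the interval, the fibration) are the
successor's.  Own work; std axioms.
-/

namespace Summit.Ventures.PercRepro2

namespace NoPocket

open Finset Classical RegionHub OneColourSwitch SideSwitch

variable {V : Type*} {E : Type*}

section Group

variable [Fintype V] [DecidableEq V] [Fintype E] [DecidableEq E]

variable (ends : E → Sym2 V)

/-- The pocket restriction of a colouring: pocket edges keep their colour, every other edge is
closed. -/
noncomputable def pocketCfg (d r s : V) (ρ ω : Config E) : Config E :=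
  fun e => if e ∈ Pk ends d r s ρ then ω e else false

/-- **The `Y`-pocket of a cube vector**: the `Y`-cluster of `d` in the pocket of its assignment. -/
noncomputable def pocketY (d r s : V) (ρ : Config E) (x : Finset (Finset V) × Finset E) :
    Set V :=
  expl ends ({d} : Set V) (pocketCfg ends d r s ρ (assignX ends x ρ))

/-- The pocket edges touching the `Y`-pocket of `x` (the edges at `d` included). -/
noncomputable def EZ (d r s : V) (ρ : Config E) (x : Finset (Finset V) × Finset E) : Finset E :=
  (Pk ends d r s ρ).filter (fun e => e ∈ touches ends (pocketY ends d r s ρ x))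

/-- The blocks that stay on the `Y`-side in the group of `x`: those adjacent to `d` and those
attached to the `Y`-pocket of `x`. -/
noncomputable def fixedBlocks (d r s : V) (ρ : Config E) (x : Finset (Finset V) × Finset E) :
    Finset (Finset V) :=
  (blocks ends d r s ρ).filter (fun C => (∃ e u, ends e = s(d, u) ∧ u ∈ C) ∨
    ∃ e u v, ends e = s(u, v) ∧ u ∈ C ∧ v ∈ pocketY ends d r s ρ x ∧ v ≠ d)

/-- The lower corner of the group interval of `x`. -/
noncomputable def groupLo (d r s : V) (ρ : Config E) (x : Finset (Finset V) × Finset E) :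
    Finset (Finset V) × Finset E :=
  (∅, x.2 ∩ EZ ends d r s ρ x)

/-- The upper corner of the group interval of `x`. -/
noncomputable def groupHi (d r s : V) (ρ : Config E) (x : Finset (Finset V) × Finset E) :
    Finset (Finset V) × Finset E :=
  (blocks ends d r s ρ \ fixedBlocks ends d r s ρ x,
    (x.2 ∩ EZ ends d r s ρ x) ∪ (Pk ends d r s ρ \ EZ ends d r s ρ x))

/-- **The group interval of `x`**: the cube vectors between the two corners. -/
noncomputable def groupInterval (d r s : V) (ρ : Config E) (x : Finset (Finset V) × Finset E) :
    Finset (Finset (Finset V) × Finset E) :=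
  (cubeP ends d r s ρ).filter (fun y => groupLo ends d r s ρ x ≤ y ∧ y ≤ groupHi ends d r s ρ x)

variable {ends}

/-- Membership in the group interval. -/
lemma mem_groupInterval {d r s : V} {ρ : Config E} {x y : Finset (Finset V) × Finset E} :
    y ∈ groupInterval ends d r s ρ x ↔
      y ∈ cubeP ends d r s ρ ∧ groupLo ends d r s ρ x ≤ y ∧ y ≤ groupHi ends d r s ρ x := by
  simp [groupInterval]

/-- The group interval lies in the cube. -/
lemma mem_cubeP_of_mem_groupInterval {d r s : V} {ρ : Config E}
    {x y : Finset (Finset V) × Finset E} (h : y ∈ groupInterval ends d r s ρ x) :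
    y ∈ cubeP ends d r s ρ :=
  (mem_groupInterval.1 h).1

/-- A member of the group interval agrees with `x` on the pocket edges touching the
`Y`-pocket of `x`. -/
lemma inter_EZ_eq_of_mem_groupInterval {d r s : V} {ρ : Config E}
    {x y : Finset (Finset V) × Finset E} (h : y ∈ groupInterval ends d r s ρ x) :
    y.2 ∩ EZ ends d r s ρ x = x.2 ∩ EZ ends d r s ρ x := by
  obtain ⟨_, hlo, hhi⟩ := mem_groupInterval.1 h
  have h1 : x.2 ∩ EZ ends d r s ρ x ⊆ y.2 := hlo.2
  have h2 : y.2 ⊆ (x.2 ∩ EZ ends d r s ρ x) ∪ (Pk ends d r s ρ \ EZ ends d r s ρ x) := hhi.2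
  ext e
  constructor
  · intro h0
    obtain ⟨hey, heZ⟩ := Finset.mem_inter.1 h0
    rcases Finset.mem_union.1 (h2 hey) with h3 | h3
    · exact h3
    · exact absurd heZ (Finset.mem_sdiff.1 h3).2
  · intro h0
    obtain ⟨hex, heZ⟩ := Finset.mem_inter.1 h0
    exact Finset.mem_inter.2 ⟨h1 (Finset.mem_inter.2 ⟨hex, heZ⟩), heZ⟩

/-- A member of the group interval flips no `T`-edge. -/
lemma notMem_Tset_of_mem_groupInterval {d r s : V} {ρ : Config E}
    {x y : Finset (Finset V) × Finset E} (h : y ∈ groupInterval ends d r s ρ x) {e : E}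
    (he : e ∈ y.2) : e ∉ Tset ends d r s := by
  intro hT
  obtain ⟨_, _, hhi⟩ := mem_groupInterval.1 h
  rcases Finset.mem_union.1 (hhi.2 he) with h3 | h3
  · exact Pk_not_mem_Tset (Finset.mem_filter.1 (Finset.mem_inter.1 h3).2).1 hT
  · exact Pk_not_mem_Tset (Finset.mem_sdiff.1 h3).1 hT

/-- A member of the group interval switches no fixed block. -/
lemma notMem_fixedBlocks_of_mem_groupInterval {d r s : V} {ρ : Config E}
    {x y : Finset (Finset V) × Finset E} (h : y ∈ groupInterval ends d r s ρ x) {C : Finset V}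
    (hC : C ∈ y.1) : C ∉ fixedBlocks ends d r s ρ x := by
  obtain ⟨_, _, hhi⟩ := mem_groupInterval.1 h
  exact (Finset.mem_sdiff.1 (hhi.1 hC)).2

/-- **The `Y`-pocket is constant on the group interval.** -/
theorem pocketY_eq_of_mem_groupInterval {p q r s d : V} {ρ : Config E}
    (hρ : ρ ∈ RepD ends p q r s d) {x y : Finset (Finset V) × Finset E}
    (hx : x ∈ cubeP ends d r s ρ) (h : y ∈ groupInterval ends d r s ρ x) :
    pocketY ends d r s ρ y = pocketY ends d r s ρ x := by
  obtain ⟨hT, _⟩ := mem_cubeP.1 hx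
  obtain ⟨hT', _⟩ := mem_cubeP.1 (mem_cubeP_of_mem_groupInterval h)
  have hagree := inter_EZ_eq_of_mem_groupInterval h
  unfold pocketY
  apply expl_eq_of_eqOn_touches
  intro e he
  simp only [pocketCfg]
  by_cases hP : e ∈ Pk ends d r s ρ
  · rw [if_pos hP, if_pos hP, assignX_Pk hρ hT hP, assignX_Pk hρ hT' hP]
    have heZ : e ∈ EZ ends d r s ρ x := Finset.mem_filter.2 ⟨hP, he⟩
    have key : e ∈ y.2 ↔ e ∈ x.2 := by
      constructor
      · intro hey
        exact (Finset.mem_inter.1 (hagree ▸ Finset.mem_inter.2 ⟨hey, heZ⟩)).1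
      · intro hex
        exact (Finset.mem_inter.1 (hagree.symm ▸ Finset.mem_inter.2 ⟨hex, heZ⟩)).1
    by_cases hey : e ∈ y.2
    · rw [if_pos (key.1 hey), if_pos hey]
    · rw [if_neg (fun h' => hey (key.2 h')), if_neg hey]
  · rw [if_neg hP, if_neg hP]

/-- A cube vector that flips no `T`-edge and switches no fixed block lies in its own group
interval. -/
lemma self_mem_groupInterval {d r s : V} {ρ : Config E} {x : Finset (Finset V) × Finset E}
    (hx : x ∈ cubeP ends d r s ρ) (hT : ∀ e ∈ x.2, e ∉ Tset ends d r s)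
    (hB : ∀ C ∈ x.1, C ∉ fixedBlocks ends d r s ρ x) :
    x ∈ groupInterval ends d r s ρ x := by
  obtain ⟨hT1, hF1⟩ := mem_cubeP.1 hx
  refine mem_groupInterval.2 ⟨hx, ⟨Finset.empty_subset _, Finset.inter_subset_left⟩, ?_, ?_⟩
  · intro C hC
    exact Finset.mem_sdiff.2 ⟨hT1 hC, hB C hC⟩
  · intro e he
    by_cases heZ : e ∈ EZ ends d r s ρ x
    · exact Finset.mem_union.2 (Or.inl (Finset.mem_inter.2 ⟨he, heZ⟩))
    · refine Finset.mem_union.2 (Or.inr (Finset.mem_sdiff.2 ⟨?_, heZ⟩))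
      rcases mem_freeE.1 (hF1 he) with hTe | hPe
      · exact absurd hTe (hT e he)
      · exact hPe

omit [Fintype V] [DecidableEq V] in
/-- The pocket restriction is below the colouring. -/
lemma pocketCfg_le {d r s : V} (ρ ω : Config E) : pocketCfg ends d r s ρ ω ≤ ω := by
  intro e
  simp only [pocketCfg]
  split_ifs
  · exact le_rfl
  · exact Bool.false_le _

omit [Fintype V] in
/-- A vertex of the `Y`-pocket is `Y`-connected to `d` in the assignment. -/
lemma conn_d_of_mem_pocketY {d r s : V} {ρ : Config E} {x : Finset (Finset V) × Finset E} {v : V}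
    (hv : v ∈ pocketY ends d r s ρ x) : Conn ends (assignX ends x ρ) d v := by
  obtain ⟨h, hh, hc⟩ := hv
  rw [Set.mem_singleton_iff] at hh
  subst hh
  exact conn_mono (pocketCfg_le ρ _) hc

omit [Fintype V] in
/-- The vertices of the `Y`-pocket lie in the unexplored part of `G − d` (which contains `d`). -/
lemma mem_Oprime_of_mem_pocketY {d r s : V} (hr : d ≠ r) (hs : d ≠ s) {ρ : Config E}
    {x : Finset (Finset V) × Finset E} {v : V} (hv : v ∈ pocketY ends d r s ρ x) :
    v ∈ Oprime ends d r s ρ := by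
  obtain ⟨h, hh, hc⟩ := hv
  rw [Set.mem_singleton_iff] at hh
  rw [hh] at hc
  have hd : d ∈ Oprime ends d r s ρ :=
    mem_Oprime.2 ⟨not_mem_K2_endsD hr hs ρ, not_mem_M2_endsD hr hs ρ⟩
  refine mem_of_conn_of_closed (ends := ends) (ω := pocketCfg ends d r s ρ (assignX ends x ρ))
    ?_ hd hc
  intro a _ b hab
  obtain ⟨_, e, he, hends⟩ := openGraph_adj.1 hab
  simp only [pocketCfg] at he
  by_cases hP : e ∈ Pk ends d r s ρ
  · obtain ⟨y, hy, z, hz, hyz⟩ := mem_Pk.1 hP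
    rw [hends, Sym2.eq_iff] at hyz
    rcases hyz with ⟨_, h2⟩ | ⟨_, h2⟩
    · rw [h2]
      exact hz
    · rw [h2]
      exact hy
  · rw [if_neg hP] at he
    exact absurd he (by decide)

/-- **A `K`-side legal point lies in its own group interval**: no `T`-edge is flipped (it would
put `d ∈ M₂`) and no fixed block is switched (a switched block adjacent to `d` puts `d ∈ M₂` or
is doubly reached; a switched block attached to the `Y`-pocket is doubly reached). -/
theorem self_mem_groupInterval_of_K {p q r s d : V} (hr : d ≠ r) (hs : d ≠ s) {ρ : Config E}
    (hρ : ρ ∈ RepP ends p q r s d) {x : Finset (Finset V) × Finset E}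
    (hx : x ∈ cubeP ends d r s ρ) (hK : d ∈ K2 ends r s (assignX ends x ρ))
    (hM : d ∉ M2 ends r s (assignX ends x ρ)) (hD : DOne ends r s d (assignX ends x ρ)) :
    x ∈ groupInterval ends d r s ρ x := by
  obtain ⟨hρD, _⟩ := mem_RepP.1 hρ
  obtain ⟨hT, hF⟩ := mem_cubeP.1 hx
  obtain ⟨_, _, hρT⟩ := mem_RepD.1 hρD
  refine self_mem_groupInterval hx ?_ ?_
  · -- a flipped `T`-edge is `W`: `d ∈ M₂`
    intro e he hTe
    apply hM
    have hval : assignX ends x ρ e = false := by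
      rw [assignX_Tset hρD hT hr hs hTe, if_pos he, hρT e hTe]
      rfl
    rcases mem_Tset.1 hTe with h2 | h2
    · exact mem_M2_iff.2 (Or.inl (conn_symm (conn_of_openAdj ⟨e, by
        simp only [OneColourSwitch.compl]; rw [hval]; rfl, h2⟩)))
    · exact mem_M2_iff.2 (Or.inr (conn_symm (conn_of_openAdj ⟨e, by
        simp only [OneColourSwitch.compl]; rw [hval]; rfl, h2⟩)))
  · intro C hC hfix
    have hCb : C ∈ blocks ends d r s ρ := (Finset.mem_filter.1 hfix).1
    -- the vertices of a switched block lie in `M₂`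
    have hM2 : ∀ u ∈ C, u ∈ M2 ends r s (assignX ends x ρ) := by
      intro u hu
      have h1 : u ∈ M2 (endsD ends d) r s (assignX ends x ρ) := by
        rw [M2_endsD_assignX' hr hs hρD hT hF]
        exact Or.inr (Finset.mem_coe.2 (mem_unionT.2 ⟨C, hC, hu⟩))
      rcases mem_M2_iff.1 h1 with h2 | h2
      · exact mem_M2_iff.2 (Or.inl (conn_of_conn_endsD h2))
      · exact mem_M2_iff.2 (Or.inr (conn_of_conn_endsD h2))
    rcases (Finset.mem_filter.1 hfix).2 with ⟨e, u, hends, hu⟩ | ⟨e, u, v, hends, hu, hv, hvd⟩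
    · -- a switched block adjacent to `d`
      obtain ⟨hur, hus, hud⟩ := block_vertex_ne hρD hCb hu hr hs
      have hval := assignX_block_edge' hρD hT hF hr hs hCb hu hends
      rw [if_pos hC] at hval
      by_cases hρe : ρ e = true
      · -- the edge is `W` at `x`: `d ∈ M₂`
        apply hM
        have hdu : Conn ends (OneColourSwitch.compl (assignX ends x ρ)) d u := by
          refine conn_of_openAdj ⟨e, ?_, hends⟩
          simp only [OneColourSwitch.compl]
          rw [hval, hρe]
          rfl
        rcases mem_M2_iff.1 (hM2 u hu) with h2 | h2
        · exact mem_M2_iff.2 (Or.inl (conn_trans h2 (conn_symm hdu)))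
        · exact mem_M2_iff.2 (Or.inr (conn_trans h2 (conn_symm hdu)))
      · -- the edge is `Y` at `x`: `u` is doubly reached
        rw [Bool.not_eq_true] at hρe
        have hdu : Conn ends (assignX ends x ρ) d u := by
          refine conn_of_openAdj ⟨e, ?_, hends⟩
          rw [hval, hρe]
          rfl
        have huK : u ∈ K2 ends r s (assignX ends x ρ) := by
          rcases mem_K2_iff.1 hK with h2 | h2
          · exact mem_K2_iff.2 (Or.inl (conn_trans h2 hdu))
          · exact mem_K2_iff.2 (Or.inr (conn_trans h2 hdu))
        exact hD u hur hus hud huK (hM2 u hu)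
    · -- a switched block attached to the `Y`-pocket: its vertex `u` is doubly reached
      obtain ⟨hur, hus, hud⟩ := block_vertex_ne hρD hCb hu hr hs
      have hvO : v ∈ Oprime ends d r s ρ := mem_Oprime_of_mem_pocketY hr hs hv
      have hval := assignX_touch_block hρD hT hF hr hs hCb hu hends
      rw [if_pos hC] at hval
      -- in the representative the edge is `W`: a `Y` edge would put `v` into the `Y`-world
      have hρe : ρ e = false := by
        by_contra hne
        rw [Bool.not_eq_false] at hne
        have huK : u ∈ K2 (endsD ends d) r s ρ := mem_K2_endsD_of_mem_block hρD hCb hu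
        have hde : d ∉ ends e := by
          rw [hends]
          intro hd
          rcases Sym2.mem_iff.1 hd with h2 | h2
          · exact hud h2.symm
          · exact hvd h2.symm
        have hconn : Conn (endsD ends d) ρ u v :=
          conn_of_openAdj ⟨e, hne, by rw [endsD_of_notMem hde]; exact hends⟩
        have hvK : v ∈ K2 (endsD ends d) r s ρ := by
          rcases mem_K2_iff.1 huK with h2 | h2
          · exact mem_K2_iff.2 (Or.inl (conn_trans h2 hconn))
          · exact mem_K2_iff.2 (Or.inr (conn_trans h2 hconn))
        exact (mem_Oprime.1 hvO).1 hvK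
      have hdu : Conn ends (assignX ends x ρ) d u := by
        refine conn_trans (conn_d_of_mem_pocketY hv) (conn_symm (conn_of_openAdj ⟨e, ?_, hends⟩))
        rw [hval, hρe]
        rfl
      have huK : u ∈ K2 ends r s (assignX ends x ρ) := by
        rcases mem_K2_iff.1 hK with h2 | h2
        · exact mem_K2_iff.2 (Or.inl (conn_trans h2 hdu))
        · exact mem_K2_iff.2 (Or.inr (conn_trans h2 hdu))
      exact hD u hur hus hud huK (hM2 u hu)

end Group

end NoPocket

end Summit.Ventures.PercRepro2
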